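import Literature.NumberTheory.LFunctions.WeilTwoPrimeOddMarginHBase
import Literature.NumberTheory.LFunctions.WeilTwoPrimeOddMarginHDataP22
import Literature.NumberTheory.LFunctions.WeilBlockRowsP
import HarnessLib

/-!
# Two-prime odd-margin certificate H: the materialized block agrees with `P_r`, rows 60–69

`WeilCert.checkPmRow` (row `k` of the claim `Pm_{kl} = P_r(2k+1, 2l+1)`) for certificate H, by `decide +kernel`. Pure proof file; nothing is asserted.
-/

noncomputable section

namespace Literature.NumberTheory.LFunctions

set_option maxHeartbeats 0 in
/-- Row 60 of the materialized block is row 60 of `P_r` (certificate H). [folklore] -/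
theorem checkPmRow1_60_weilCert23H : weilCert23HBase.checkPmRow weilCert23HNu weilCert23HPm 1 60 = true := by
  decide +kernel

set_option maxHeartbeats 0 in
/-- Row 61 of the materialized block is row 61 of `P_r` (certificate H). [folklore] -/
theorem checkPmRow1_61_weilCert23H : weilCert23HBase.checkPmRow weilCert23HNu weilCert23HPm 1 61 = true := by
  decide +kernel

set_option maxHeartbeats 0 in
/-- Row 62 of the materialized block is row 62 of `P_r` (certificate H). [folklore] -/
theorem checkPmRow1_62_weilCert23H : weilCert23HBase.checkPmRow weilCert23HNu weilCert23HPm 1 62 = true := by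
  decide +kernel

set_option maxHeartbeats 0 in
/-- Row 63 of the materialized block is row 63 of `P_r` (certificate H). [folklore] -/
theorem checkPmRow1_63_weilCert23H : weilCert23HBase.checkPmRow weilCert23HNu weilCert23HPm 1 63 = true := by
  decide +kernel

set_option maxHeartbeats 0 in
/-- Row 64 of the materialized block is row 64 of `P_r` (certificate H). [folklore] -/
theorem checkPmRow1_64_weilCert23H : weilCert23HBase.checkPmRow weilCert23HNu weilCert23HPm 1 64 = true := by
  decide +kernel

set_option maxHeartbeats 0 in
/-- Row 65 of the materialized block is row 65 of `P_r` (certificate H). [folklore] -/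
theorem checkPmRow1_65_weilCert23H : weilCert23HBase.checkPmRow weilCert23HNu weilCert23HPm 1 65 = true := by
  decide +kernel

set_option maxHeartbeats 0 in
/-- Row 66 of the materialized block is row 66 of `P_r` (certificate H). [folklore] -/
theorem checkPmRow1_66_weilCert23H : weilCert23HBase.checkPmRow weilCert23HNu weilCert23HPm 1 66 = true := by
  decide +kernel

set_option maxHeartbeats 0 in
/-- Row 67 of the materialized block is row 67 of `P_r` (certificate H). [folklore] -/
theorem checkPmRow1_67_weilCert23H : weilCert23HBase.checkPmRow weilCert23HNu weilCert23HPm 1 67 = true := by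
  decide +kernel

set_option maxHeartbeats 0 in
/-- Row 68 of the materialized block is row 68 of `P_r` (certificate H). [folklore] -/
theorem checkPmRow1_68_weilCert23H : weilCert23HBase.checkPmRow weilCert23HNu weilCert23HPm 1 68 = true := by
  decide +kernel

set_option maxHeartbeats 0 in
/-- Row 69 of the materialized block is row 69 of `P_r` (certificate H). [folklore] -/
theorem checkPmRow1_69_weilCert23H : weilCert23HBase.checkPmRow weilCert23HNu weilCert23HPm 1 69 = true := by
  decide +kernel


end Literature.NumberTheory.LFunctions
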